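import Literature.NumberTheory.Automorphic.UnitaryGroupDiscreteRepCentralCharacter
import Mathlib.NumberTheory.NumberField.CMField
import HarnessLib

/-!
# Crux `HLiu418`, line LD1 — ROAD O brick (η): vector laws and the central character TRAVEL along an intertwining
# equivalence of closed subrepresentations (the transport one-liners (T1) and the central-character transport (T2))

Cell hodgecm-mathlib (D-0151), FLOOR 0; crux item `HLiu418` = stmt-HodgeConjecture-24832; seat LD1-p02 (g6), dealt BY NAME
(ROAD O HANDS v3, chair LD1-plan (g3) 2026-09-02T13:04:48Z).  THEOREMS ONLY (no definition, no named fact, no instance, no notation,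
no `sorry`); pure Hilbert-space ∕ `ContRepresentation` currency over ★ `HilbertRepSpectrum` (`ClosedSubrep`, `toContRep`,
`AreUnitarilyEquivalent := ∃ e : π.Equiv σ, Isometry e`) and ★ `UnitaryGroupDiscreteRepCentralCharacter`.

THE MATHEMATICS ([Dixmier1977, §13.1.3]; [DeitmarEchterhoff2014, Lemma 6.1.7]).  Let `π` be a continuous representation of `G` on `V`,
`P, Q ≤ V` closed invariant subspaces and `e : P ≃ Q` an intertwining (continuous linear) equivalence of the restricted
representations — isometry is NOT needed anywhere below.  Then every OPERATOR LAW on a vector travels: if `v ∈ P` and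
`π(x) v = c • v` then `π(x) (e v) = c • (e v)` (because `e (π(x) v) = π(x) (e v)` and `e` is linear), `e v ≠ 0` when `v ≠ 0`
(`e` is injective), and `e v ∈ Q`; hence any FAMILY of laws `π(x_i) v = c_i • v` (guarded by predicates `p_i`) witnessed by a
non-zero vector of `P` is witnessed by a non-zero vector of `Q` (T1).  A law holding on ALL of `P` holds on all of `Q`
(apply the pointwise statement to `e⁻¹ w`).  In particular, for `P, Q` discrete automorphic representations of an adelic unitary group
`U(J)(𝔸_F)` (★ `DiscreteAutomorphicRep (UnitaryGroup.adelicGroupData F E c N J) μ`), on which the centre `U(1)(𝔸_F)` acts through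
characters `ψ_P`, `ψ_Q` (★ `DiscreteAutomorphicRep.exists_centralCharacter_adelicCenter`, [BorelJacquet1979, §4.6]): if `P ≃ᵤ Q`
then the centre acts on `Q` through `ψ_P` as well (T2), and `ψ_P = ψ_Q` (evaluate both laws at one non-zero vector of `Q`).

ROLE ON ROAD O («orthogonal copy», memo `F0/P6/LD/LD1-p01/g5/ROAD-O-orthogonal-copy.v1.LD1-p01g5.md` §2 (v)): (T2) is the owed
brick (η) «`Q ≃ᵤ Q″` ⇒ equal central characters», consumed by the pin assembly `F0LD1ThetaSpanPinOfBricks` (LD1-p01) immediately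
before ★ `F0P6LD1ThetaCharacterPin.charCM_eq_of_seams_of_centralCharacter_eq` (whose `hχP`∕`hχP'` binders are the conclusion
shape of `centralCharacter_transport` verbatim); (T1) are the citable transports of the «`R(x) w = c • w`» laws used by the
`hcov`-discharge of brick (β) (LD2-p02) and by the vector laws of brick (δ) (LD2-p01).  Nothing here mentions hol₂, σ, theta
lifts or the printed letters; no digit of HC_CM moves by this file.
[cite: Dixmier1977, §13.1.3] [cite: DeitmarEchterhoff2014, Lemma 6.1.7] [cite: BorelJacquet1979, §4.6]
-/

-- the mandated namespace has the single-problem summit's repeated segment (`HodgeConjecture.HodgeConjecture`)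
set_option linter.dupNamespace false

namespace Summit.HodgeConjecture.HodgeConjecture.Cruxes.HLiu418.F0LD1UnitaryEquivTransport

open Literature.NumberTheory.Automorphic Literature.NumberTheory.Automorphic.UnitaryGroup

/-! ## §1 (T1) — vector laws travel along an intertwining equivalence `e : P.toContRep ≃ Q.toContRep` -/

section Transport

variable {R G V : Type*} [Ring R] [Monoid G] [AddCommGroup V] [TopologicalSpace V] [IsTopologicalAddGroup V]
  [Module R V] {π : ContRepresentation R G V} {P Q : ContRepresentation.ClosedSubrep π}

/-- **(T1-0) pointwise intertwining** of an equivalence of closed subrepresentations, in the subtypes: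
`e (π(g)|_P v) = π(g)|_Q (e v)`. [cite: Dixmier1977, §13.1.3] -/
theorem equiv_apply_toContRep (e : P.toContRep.Equiv Q.toContRep) (g : G) (v : P.toSubmodule) :
    e (P.toContRep g v) = Q.toContRep g (e v) :=
  congrArg (fun T : P.toSubmodule →L[R] Q.toSubmodule => T v) (e.isIntertwining g)

/-- **(T1c) membership** — the transported vector lies in `Q` (ambient form). [cite: Dixmier1977, §13.1.3] -/
theorem coe_equiv_mem (e : P.toContRep.Equiv Q.toContRep) {v : V} (hv : v ∈ P.toSubmodule) :
    ((e ⟨v, hv⟩ : Q.toSubmodule) : V) ∈ Q.toSubmodule :=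
  (e ⟨v, hv⟩).2

/-- **(T1b) non-vanishing travels** — `v ≠ 0 ⇒ e v ≠ 0` (ambient form; `e` is injective). [cite: Dixmier1977, §13.1.3] -/
theorem coe_equiv_ne_zero (e : P.toContRep.Equiv Q.toContRep) {v : V} (hv : v ∈ P.toSubmodule) (h0 : v ≠ 0) :
    ((e ⟨v, hv⟩ : Q.toSubmodule) : V) ≠ 0 := by
  intro h
  apply h0
  have h' : e ⟨v, hv⟩ = 0 := Subtype.ext h
  have h'' : (⟨v, hv⟩ : P.toSubmodule) = 0 := (EquivLike.injective e) (by rw [h', map_zero])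
  exact congrArg Subtype.val h''

/-- **(T1a) an operator law travels** (ambient form): if `v ∈ P` and `π x v = c • v` then `π x (e v) = c • (e v)` in `V`.
[cite: Dixmier1977, §13.1.3] -/
theorem apply_coe_equiv_eq_smul (e : P.toContRep.Equiv Q.toContRep) {v : V} (hv : v ∈ P.toSubmodule)
    {x : G} {c : R} (h : π x v = c • v) :
    π x ((e ⟨v, hv⟩ : Q.toSubmodule) : V) = c • ((e ⟨v, hv⟩ : Q.toSubmodule) : V) := by
  have h1 : P.toContRep x ⟨v, hv⟩ = c • (⟨v, hv⟩ : P.toSubmodule) := by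
    apply Subtype.ext
    rw [ContRepresentation.ClosedSubrep.coe_toContRep_apply, Submodule.coe_smul]
    exact h
  have h2 := equiv_apply_toContRep e x ⟨v, hv⟩
  rw [h1, map_smul] at h2
  have h3 := congrArg (fun w : Q.toSubmodule => (w : V)) h2
  simp only [Submodule.coe_smul, ContRepresentation.ClosedSubrep.coe_toContRep_apply] at h3
  exact h3.symm

/-- **(T1d) a guarded family of operator laws witnessed by a non-zero vector of `P` is witnessed by a non-zero vector of `Q`**
(ambient form; index type `ι`, guards `p`, group elements `x`, scalars `c` arbitrary — e.g. brick (β)'s `hcov` per cone frame).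
[cite: Dixmier1977, §13.1.3] -/
theorem exists_mem_ne_zero_laws_of_equiv (e : P.toContRep.Equiv Q.toContRep) {ι : Sort*} (p : ι → Prop) (x : ι → G)
    (c : ι → R) (h : ∃ v ∈ P.toSubmodule, v ≠ 0 ∧ ∀ i, p i → π (x i) v = c i • v) :
    ∃ w ∈ Q.toSubmodule, w ≠ 0 ∧ ∀ i, p i → π (x i) w = c i • w := by
  obtain ⟨v, hv, hv0, hlaw⟩ := h
  exact ⟨_, coe_equiv_mem e hv, coe_equiv_ne_zero e hv hv0, fun i hi => apply_coe_equiv_eq_smul e hv (hlaw i hi)⟩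

/-- **(T1d′) unguarded family version** of `exists_mem_ne_zero_laws_of_equiv`. [cite: Dixmier1977, §13.1.3] -/
theorem exists_mem_ne_zero_laws_of_equiv' (e : P.toContRep.Equiv Q.toContRep) {ι : Sort*} (x : ι → G) (c : ι → R)
    (h : ∃ v ∈ P.toSubmodule, v ≠ 0 ∧ ∀ i, π (x i) v = c i • v) :
    ∃ w ∈ Q.toSubmodule, w ≠ 0 ∧ ∀ i, π (x i) w = c i • w := by
  obtain ⟨v, hv, hv0, hlaw⟩ := h
  exact ⟨_, coe_equiv_mem e hv, coe_equiv_ne_zero e hv hv0, fun i => apply_coe_equiv_eq_smul e hv (hlaw i)⟩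

/-- **(T1e) a law on ALL of `P` holds on all of `Q`** (subtype form): `(∀ v, π(x)|_P v = c • v) ⇒ ∀ w, π(x)|_Q w = c • w`
(apply (T1-0) to `e⁻¹ w`).  This is the shape of the central-character law. [cite: Dixmier1977, §13.1.3] -/
theorem toContRep_apply_eq_smul_of_equiv (e : P.toContRep.Equiv Q.toContRep) {x : G} {c : R}
    (h : ∀ v : P.toSubmodule, P.toContRep x v = c • v) (w : Q.toSubmodule) : Q.toContRep x w = c • w := by
  have h1 := equiv_apply_toContRep e x (e.symm w)
  rw [h (e.symm w), map_smul, e.apply_symm_apply] at h1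
  exact h1.symm

/-- **(T1e, ambient form)**: `(∀ v ∈ P, π x v = c • v) ⇒ ∀ w ∈ Q, π x w = c • w`. [cite: Dixmier1977, §13.1.3] -/
theorem apply_eq_smul_of_mem_of_equiv (e : P.toContRep.Equiv Q.toContRep) {x : G} {c : R}
    (h : ∀ v ∈ P.toSubmodule, π x v = c • v) {w : V} (hw : w ∈ Q.toSubmodule) : π x w = c • w := by
  have h' : ∀ v : P.toSubmodule, P.toContRep x v = c • v := fun v => by
    apply Subtype.ext
    rw [ContRepresentation.ClosedSubrep.coe_toContRep_apply, Submodule.coe_smul]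
    exact h v v.2
  have h1 := congrArg (fun u : Q.toSubmodule => (u : V)) (toContRep_apply_eq_smul_of_equiv e h' ⟨w, hw⟩)
  simp only [Submodule.coe_smul, ContRepresentation.ClosedSubrep.coe_toContRep_apply] at h1
  exact h1

end Transport

/-! ## §1′ The same, from `AreUnitarilyEquivalent` (seminormed spaces; the isometry is discarded) -/

section Normed

variable {R G V : Type*} [Ring R] [Monoid G] [SeminormedAddCommGroup V] [Module R V]
  {π : ContRepresentation R G V} {P Q : ContRepresentation.ClosedSubrep π}

/-- **(T1d) from a unitary equivalence**: a guarded family of operator laws witnessed by a non-zero vector of `P` is witnessed by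
a non-zero vector of `Q` whenever `P.toContRep ≃ᵤ Q.toContRep`. [cite: Dixmier1977, §13.1.3] -/
theorem exists_mem_ne_zero_laws_of_areUnitarilyEquivalent
    (he : ContRepresentation.AreUnitarilyEquivalent P.toContRep Q.toContRep) {ι : Sort*} (p : ι → Prop) (x : ι → G)
    (c : ι → R) (h : ∃ v ∈ P.toSubmodule, v ≠ 0 ∧ ∀ i, p i → π (x i) v = c i • v) :
    ∃ w ∈ Q.toSubmodule, w ≠ 0 ∧ ∀ i, p i → π (x i) w = c i • w := by
  obtain ⟨e, -⟩ := he
  exact exists_mem_ne_zero_laws_of_equiv e p x c h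

/-- **(T1d′) from a unitary equivalence**, unguarded. [cite: Dixmier1977, §13.1.3] -/
theorem exists_mem_ne_zero_laws_of_areUnitarilyEquivalent'
    (he : ContRepresentation.AreUnitarilyEquivalent P.toContRep Q.toContRep) {ι : Sort*} (x : ι → G) (c : ι → R)
    (h : ∃ v ∈ P.toSubmodule, v ≠ 0 ∧ ∀ i, π (x i) v = c i • v) :
    ∃ w ∈ Q.toSubmodule, w ≠ 0 ∧ ∀ i, π (x i) w = c i • w := by
  obtain ⟨e, -⟩ := he
  exact exists_mem_ne_zero_laws_of_equiv' e x c h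

/-- **(T1e) from a unitary equivalence**: a law on all of `P` holds on all of `Q` (subtype form). [cite: Dixmier1977, §13.1.3] -/
theorem toContRep_apply_eq_smul_of_areUnitarilyEquivalent
    (he : ContRepresentation.AreUnitarilyEquivalent P.toContRep Q.toContRep) {x : G} {c : R}
    (h : ∀ v : P.toSubmodule, P.toContRep x v = c • v) (w : Q.toSubmodule) : Q.toContRep x w = c • w := by
  obtain ⟨e, -⟩ := he
  exact toContRep_apply_eq_smul_of_equiv e h w

/-- **(T1e) from a unitary equivalence**, ambient form. [cite: Dixmier1977, §13.1.3] -/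
theorem apply_eq_smul_of_mem_of_areUnitarilyEquivalent
    (he : ContRepresentation.AreUnitarilyEquivalent P.toContRep Q.toContRep) {x : G} {c : R}
    (h : ∀ v ∈ P.toSubmodule, π x v = c • v) {w : V} (hw : w ∈ Q.toSubmodule) : π x w = c • w := by
  obtain ⟨e, -⟩ := he
  exact apply_eq_smul_of_mem_of_equiv e h hw

end Normed

/-! ## §2 (T2) = brick (η) — the central character of a discrete automorphic representation of `U(J)(𝔸_F)` travels along `≃ᵤ` -/

section CentralCharacter

open NumberField MeasureTheory

variable {F E : Type} [Field F] [NumberField F] [Field E] [NumberField E] [Algebra F E]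
  {c : E ≃ₐ[F] E} {N : ℕ} {J : Matrix (Fin N) (Fin N) E}
  {μ : Measure (adelicGroupData F E c N J).automorphicQuotient}
  [SMulInvariantMeasure (adelicGroupData F E c N J).Adelic (adelicGroupData F E c N J).automorphicQuotient μ]

/-- **(T2) central-character transport (η).**  If `P ≃ᵤ Q` are discrete automorphic representations of `U(J)(𝔸_F)` in the same
`L²` and the centre `U(1)(𝔸_F)` acts on `P` through `χ` (`R(u · 1_N) v = χ(u) • v` on `P`, the conclusion shape of ★
`DiscreteAutomorphicRep.exists_centralCharacter_adelicCenter`), then the centre acts on `Q` through the SAME `χ` — the `hχP'` binder of ★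
`F0P6LD1ThetaCharacterPin.charCM_eq_of_seams_of_centralCharacter_eq` verbatim. [cite: BorelJacquet1979, §4.6] [cite: Dixmier1977, §13.1.3] -/
theorem centralCharacter_transport (P Q : DiscreteAutomorphicRep (adelicGroupData F E c N J) μ)
    (he : ContRepresentation.AreUnitarilyEquivalent P.space.toContRep Q.space.toContRep)
    {χ : ↥(adelicOne F E c) →* ℂˣ}
    (hχP : ∀ (u : ↥(adelicOne F E c)) (v : P.space.toSubmodule),
      P.space.toContRep (adelicCenter F E c N J u) v = ((χ u : ℂˣ) : ℂ) • v) :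
    ∀ (u : ↥(adelicOne F E c)) (w : Q.space.toSubmodule),
      Q.space.toContRep (adelicCenter F E c N J u) w = ((χ u : ℂˣ) : ℂ) • w := by
  obtain ⟨e, -⟩ := he
  intro u w
  exact toContRep_apply_eq_smul_of_equiv e (hχP u) w

/-- **(T2′) unitarily equivalent discrete automorphic representations have EQUAL central characters.**  If `P ≃ᵤ Q` and the centre acts
on `P` through `χP` and on `Q` through `χQ`, then `χP = χQ` (evaluate both laws at one non-zero vector of the irreducible, hence non-zero,
`Q`; [DeitmarEchterhoff2014, Lemma 6.1.7]). [cite: BorelJacquet1979, §4.6] [cite: DeitmarEchterhoff2014, Lemma 6.1.7] -/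
theorem centralCharacter_eq_of_areUnitarilyEquivalent (P Q : DiscreteAutomorphicRep (adelicGroupData F E c N J) μ)
    (he : ContRepresentation.AreUnitarilyEquivalent P.space.toContRep Q.space.toContRep)
    {χP χQ : ↥(adelicOne F E c) →* ℂˣ}
    (hχP : ∀ (u : ↥(adelicOne F E c)) (v : P.space.toSubmodule),
      P.space.toContRep (adelicCenter F E c N J u) v = ((χP u : ℂˣ) : ℂ) • v)
    (hχQ : ∀ (u : ↥(adelicOne F E c)) (w : Q.space.toSubmodule),
      Q.space.toContRep (adelicCenter F E c N J u) w = ((χQ u : ℂˣ) : ℂ) • w) :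
    χP = χQ := by
  haveI : Nontrivial Q.space.toSubmodule := ((ContRepresentation.isTopIrreducible_iff _).mp Q.irreducible).1
  obtain ⟨w, hw⟩ := exists_ne (0 : Q.space.toSubmodule)
  refine MonoidHom.ext fun u => Units.ext ?_
  have h1 := centralCharacter_transport P Q he hχP u w
  rw [hχQ u w] at h1
  exact (smul_left_injective ℂ hw h1).symm

end CentralCharacter

section CentralCharacterExists

open NumberField MeasureTheory

variable {F E : Type} [Field F] [NumberField F] [Field E] [NumberField E] [Algebra F E]
  {c : E ≃ₐ[F] E} {N : ℕ} {J : Matrix (Fin N) (Fin N) E}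
  {μ : Measure (adelicGroupData F E c N J).automorphicQuotient} [(adelicGroupData F E c N J).IsAutomorphicMeasure μ]

/-- **(T2″) existence form**: if `P ≃ᵤ Q` there is ONE character `χ` of `U(1)(𝔸_F)` — unitary, continuous, trivial on the rational centre —
through which the centre acts on BOTH `P` and `Q` (★ `exists_centralCharacter_adelicCenter` for `P`, transported to `Q` by (T2)).
[cite: BorelJacquet1979, §4.6] [cite: Dixmier1977, §13.1.3] -/
theorem exists_common_centralCharacter_of_areUnitarilyEquivalent
    (P Q : DiscreteAutomorphicRep (adelicGroupData F E c N J) μ)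
    (he : ContRepresentation.AreUnitarilyEquivalent P.space.toContRep Q.space.toContRep) :
    ∃ χ : ↥(adelicOne F E c) →* ℂˣ,
      (∀ u, ‖((χ u : ℂˣ) : ℂ)‖ = 1) ∧ Continuous (fun u => ((χ u : ℂˣ) : ℂ)) ∧
      (∀ u, adelicCenter F E c N J u ∈ (toAdelic F E c N J).range → χ u = 1) ∧
      (∀ (u : ↥(adelicOne F E c)) (v : P.space.toSubmodule),
        P.space.toContRep (adelicCenter F E c N J u) v = ((χ u : ℂˣ) : ℂ) • v) ∧
      ∀ (u : ↥(adelicOne F E c)) (w : Q.space.toSubmodule),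
        Q.space.toContRep (adelicCenter F E c N J u) w = ((χ u : ℂˣ) : ℂ) • w := by
  obtain ⟨χ, h1, h2, h3, h4⟩ := P.exists_centralCharacter_adelicCenter
  exact ⟨χ, h1, h2, h3, h4, centralCharacter_transport P Q he h4⟩

end CentralCharacterExists

/-! ## §3 (η) in the CM-field currency of the LD leaves (`F := L⁺ = maximalRealSubfield L`, `E := L`, `c := complexConj`) — verbatim corollaries -/

section CM

open NumberField MeasureTheory

variable (L : Type) [Field L] [NumberField L] [IsCMField L] (N : ℕ) (H : Matrix (Fin N) (Fin N) L)
  {ν : Measure (adelicGroupData (↥(maximalRealSubfield L)) L (IsCMField.complexConj L) N H).automorphicQuotient}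
  [SMulInvariantMeasure (adelicGroupData (↥(maximalRealSubfield L)) L (IsCMField.complexConj L) N H).Adelic
    (adelicGroupData (↥(maximalRealSubfield L)) L (IsCMField.complexConj L) N H).automorphicQuotient ν]

/-- **(η) for `U(H)(𝔸_{L⁺})`, `L` a CM field** — the `hχP'` binder of ★ `F0P6LD1ThetaCharacterPin.charCM_eq_of_seams_of_centralCharacter_eq`
produced from its `hχP` binder and `P ≃ᵤ P′` (= `centralCharacter_transport` at `F := L⁺`, `E := L`, `c := complexConj`).
[cite: BorelJacquet1979, §4.6] [cite: Dixmier1977, §13.1.3] -/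
theorem centralCharacter_transport₂
    (P P' : DiscreteAutomorphicRep (adelicGroupData (↥(maximalRealSubfield L)) L (IsCMField.complexConj L) N H) ν)
    (he : ContRepresentation.AreUnitarilyEquivalent P.space.toContRep P'.space.toContRep)
    {χ : ↥(adelicOne (↥(maximalRealSubfield L)) L (IsCMField.complexConj L)) →* ℂˣ}
    (hχP : ∀ (u : ↥(adelicOne (↥(maximalRealSubfield L)) L (IsCMField.complexConj L))) (v : P.space.toSubmodule),
      P.space.toContRep (adelicCenter (↥(maximalRealSubfield L)) L (IsCMField.complexConj L) N H u) v = ((χ u : ℂˣ) : ℂ) • v) :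
    ∀ (u : ↥(adelicOne (↥(maximalRealSubfield L)) L (IsCMField.complexConj L))) (v : P'.space.toSubmodule),
      P'.space.toContRep (adelicCenter (↥(maximalRealSubfield L)) L (IsCMField.complexConj L) N H u) v = ((χ u : ℂˣ) : ℂ) • v :=
  centralCharacter_transport P P' he hχP

/-- **(η′) for `U(H)(𝔸_{L⁺})`** — unitarily equivalent discrete automorphic representations of `U(H)` have equal central characters
(= `centralCharacter_eq_of_areUnitarilyEquivalent` at `F := L⁺`, `E := L`, `c := complexConj`). [cite: BorelJacquet1979, §4.6]
[cite: DeitmarEchterhoff2014, Lemma 6.1.7] -/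
theorem centralCharacter_eq_of_areUnitarilyEquivalent₂
    (P P' : DiscreteAutomorphicRep (adelicGroupData (↥(maximalRealSubfield L)) L (IsCMField.complexConj L) N H) ν)
    (he : ContRepresentation.AreUnitarilyEquivalent P.space.toContRep P'.space.toContRep)
    {χP χP' : ↥(adelicOne (↥(maximalRealSubfield L)) L (IsCMField.complexConj L)) →* ℂˣ}
    (hχP : ∀ (u : ↥(adelicOne (↥(maximalRealSubfield L)) L (IsCMField.complexConj L))) (v : P.space.toSubmodule),
      P.space.toContRep (adelicCenter (↥(maximalRealSubfield L)) L (IsCMField.complexConj L) N H u) v = ((χP u : ℂˣ) : ℂ) • v)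
    (hχP' : ∀ (u : ↥(adelicOne (↥(maximalRealSubfield L)) L (IsCMField.complexConj L))) (v : P'.space.toSubmodule),
      P'.space.toContRep (adelicCenter (↥(maximalRealSubfield L)) L (IsCMField.complexConj L) N H u) v = ((χP' u : ℂˣ) : ℂ) • v) :
    χP = χP' :=
  centralCharacter_eq_of_areUnitarilyEquivalent P P' he hχP hχP'

end CM

end Summit.HodgeConjecture.HodgeConjecture.Cruxes.HLiu418.F0LD1UnitaryEquivTransport
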